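import Summits.QuantumFields.BalabanUV.Beta.GAN24.WoodburyFibreZeroModeOsc

/-!
# GAN24 / WoodburyFibreZeroModeOscField — field-rows-only data suffice for the contour oscillation of the zero-mode gain
# (XREAD C-gan24leaf13-g22-1 INFO I1 made a theorem; census row V14 of `HOME/b2b-balaban-gan24-p3/WOODBURY-FIBRE.md` v8.3; binder row G-an2-4 ∕ (CONV-C), P3, gen 8)

Cell `pub-balaban`, β sub-cell.  HONEST FRAMING (verbatim): discharging `BetaPertH` makes Bałaban's UV stability UNCONDITIONAL — a real
constructive-QFT result; it is NOT the continuum limit and NOT the Clay problem.  HONEST DEPENDENCY (verbatim): continuum YM on T⁴ ⇐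
BetaPertH ∧ nine spine estimates (0/9 proved); BetaPertH ⇐ (D1) ∧ (D4) ∧ CAP+tail; G-an2-4 gates asym, D1 and NE2/3/4.  NOT IN PRINT; OUR
BOOKKEEPING.  [folklore] over `WoodburyFibreZeroModeOsc` BY NAME; cites nothing, mints no `def … : Prop`, instantiates no wall binder.  Since `contourRef`
∕ `contourRefL` leave the multiplier rows ∕ columns untouched, the forward-difference datum is needed on the FIELD rows `(inl κ)` only (the shape road P1's
«W3-LEGS*» data come in): **`decays_sub_contourRef_of_field`**, **`decays_sub_contourRefL_of_field`** — same constants as `decays_sub_contourRef(L)`.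
Discharges NOTHING of (CONV-C), the W-slot, «T2Shape», (D1); NEVER «G-an2-4 closed»; NOT BetaPertH, NOT continuum, NOT Clay.
-/

noncomputable section

open Finset
open scoped BigOperators
open Literature.MathematicalPhysics.QuantumFieldTheory
open Literature.MathematicalPhysics.QuantumFieldTheory.Balaban1983to89
open Literature.MathematicalPhysics.QuantumFieldTheory.Balaban1983to89.Beta
open B12Sec2to5 (l1 l1_nonneg)
open ExpKernelCalculus (MKer Decays)
open AffineAveraging (unitVec)
open OneStepResolventKernel (Fib)
open Summit.QuantumFields.BalabanUV.Beta.GAN24.WoodburyFibreZeroModeGain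
open Summit.QuantumFields.BalabanUV.Beta.GAN24.WoodburyFibreZeroModeOsc

namespace Summit.QuantumFields.BalabanUV.Beta.GAN24.WoodburyFibreZeroModeOscField

section FieldRowsOnly

variable {d : ℕ} {N : ℕ} [NeZero N]

/-- **OSCILLATION OVER THE CONTOURS FROM FIELD-ROW DATA ONLY (right leg)**: since `contourRef` leaves the multiplier rows untouched, a
forward-difference bound on the FIELD rows `(inl κ)` of `J` alone gives `Decays (J − contourRef N J) ((d+2)(N−1)·ε·e^{2δ(d+2)(N−1)}) δ`.
[folklore] -/
theorem decays_sub_contourRef_of_field {J : MKer (d + 1) (Fib d)} {ε δ : ℝ} (hε : 0 ≤ ε) (hδ : 0 ≤ δ)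
    (hD : ∀ μ y z (κ : Fin (d + 1)) b, |J (y + unitVec μ) z (Sum.inl κ) b - J y z (Sum.inl κ) b| ≤ ε * Real.exp (-δ * l1 (y - z))) :
    Decays (J - contourRef N J)
      ((((d : ℝ) + 2) * ((N : ℝ) - 1)) * ε * Real.exp (2 * δ * (((d : ℝ) + 2) * ((N : ℝ) - 1)))) δ := by
  intro y z f b
  have hN1 : (0 : ℝ) ≤ (N : ℝ) - 1 := by
    have : (1 : ℝ) ≤ N := by exact_mod_cast Nat.pos_of_ne_zero (NeZero.ne N)
    linarith
  cases f with
  | inr κ =>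
      have h0 : (J - contourRef N J) y z (Sum.inr κ) b = 0 := by simp [contourRef]
      rw [h0, abs_zero]; positivity
  | inl κ =>
      rw [sub_contourRef_inl]
      exact abs_avg_le fun s hs => abs_sub_of_offset (g := fun w => J w z (Sum.inl κ) b) hε hδ (fun μ w => hD μ w z κ b)
        (zsmul_quo_add_contourOff (N := N) y κ s) (sum_contourOff_le (N := N) y κ hs)

/-- **OSCILLATION OVER THE CONTOURS FROM FIELD-COLUMN DATA ONLY (left leg)**. [folklore] -/
theorem decays_sub_contourRefL_of_field {A : MKer (d + 1) (Fib d)} {ε δ : ℝ} (hε : 0 ≤ ε) (hδ : 0 ≤ δ)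
    (hD : ∀ μ x y a (κ : Fin (d + 1)), |A x (y + unitVec μ) a (Sum.inl κ) - A x y a (Sum.inl κ)| ≤ ε * Real.exp (-δ * l1 (x - y))) :
    Decays (A - contourRefL N A)
      ((((d : ℝ) + 2) * ((N : ℝ) - 1)) * ε * Real.exp (2 * δ * (((d : ℝ) + 2) * ((N : ℝ) - 1)))) δ := by
  intro x y a f
  have hN1 : (0 : ℝ) ≤ (N : ℝ) - 1 := by
    have : (1 : ℝ) ≤ N := by exact_mod_cast Nat.pos_of_ne_zero (NeZero.ne N)
    linarith
  cases f with
  | inr κ =>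
      have h0 : (A - contourRefL N A) x y a (Sum.inr κ) = 0 := by simp [contourRefL]
      rw [h0, abs_zero]; positivity
  | inl κ =>
      rw [sub_contourRefL_inl]
      refine abs_avg_le fun s hs => ?_
      have h := abs_sub_of_offset (g := fun w => A x w a (Sum.inl κ)) (z := x) hε hδ
        (fun μ w => by rw [ExpKernelCalculus.l1_sub_symm]; exact hD μ x w a κ)
        (zsmul_quo_add_contourOff (N := N) y κ s) (sum_contourOff_le (N := N) y κ hs)
      rw [ExpKernelCalculus.l1_sub_symm] at h
      exact h

end FieldRowsOnly

end Summit.QuantumFields.BalabanUV.Beta.GAN24.WoodburyFibreZeroModeOscField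

end
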